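import Literature.AlgebraicGeometry.HodgeTheory.AbsoluteHodgeClasses
import Literature.Geometry.Kaehler.MatrixFormLocalCalculus
import Literature.NumberTheory.Transcendental.OneFormWedgeDeterminant
import Literature.NumberTheory.Transcendental.FormsAlgebraWedgeCommProofs
import HarnessLib

/-!
# Calculus of realised algebraic form expressions

For an algebraic `k`-form expression `ξ = ∑ⱼ fⱼ dg_{j,1} ∧ ⋯ ∧ dg_{j,k}` on a smooth affine
`ℂ`-scheme `Y` (`AlgFormExpr`, coefficients and arguments in `Γ(Y, 𝒪)`) and an analytic model
`A` of `Y` (`AnalyticModel`), the realisation `ξ.realize A` (`AbsoluteHodgeClasses`) is the smooth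
complex `k`-form `∑ⱼ (fⱼ ∘ φ) d(g_{j,1} ∘ φ) ∧ ⋯` on `Y^an`. This file proves its calculus:

* regular functions read on `Y^an` are real `C^∞` (holomorphic by `IsAnalytification`, hence
  smooth; private copies `contMDiff_regularFun'` of the lemmas of `AnalyticModelRealizePullback`,
  kept private to avoid an import of that file's heavier dependencies);
* `AlgFormExpr.isSmoothForm_realize` — realisations are smooth forms;
* `AlgFormExpr.D` — the FORMAL exterior derivative `∑ⱼ 1 · dfⱼ ∧ dg_{j,1} ∧ ⋯` of an expression,
  with `AlgFormExpr.conj_D` (it commutes with conjugation of expressions) and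
  **`AlgFormExpr.mextDeriv_realize`: `d(ξ.realize A) = (ξ.D).realize A`** (Leibniz rule and
  `d ∘ d = 0` of the tree's form calculus, `WedgeFacts` proved);
* `dWedge_apply`, `AlgFormExpr.realize_apply` — the POINTWISE formula: at `x`, `ξ.realize A` is
  `∑ⱼ fⱼ(φ x) · (dg_{j,1})ₓ ∧ ⋯`, an iterated wedge of `1`-forms
  (`ContinuousAlternatingMap.iterWedge`, a determinant).

Consequently closedness of a realisation is the vanishing of another realisation
(`AlgFormExpr.realize_mem_cclosedSmoothForms_iff`), which is how the conjugation-invariance of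
closedness (`conj_realize_mem_cclosedSmoothForms`) is reduced to the injectivity of realisation.

## References

* A. Grothendieck, *On the de Rham cohomology of algebraic varieties*, Publ. IHÉS 29 (1966), §1.
* F. Charles, C. Schnell, *Notes on absolute Hodge classes* (2014), §11.2.2.
* F. W. Warner, *Foundations of Differentiable Manifolds and Lie Groups* (1983), 2.20.
-/

noncomputable section

open scoped Manifold ContDiff Topology
open CategoryTheory AlgebraicGeometry Filter
open Literature.NumberTheory.Transcendental Literature.Geometry.Kaehler

namespace Literature.AlgebraicGeometry.HodgeTheory

section HodgeTheory

/-! ### Pointwise shape and smoothness of `dFun`, `dWedge` -/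

section Forms

variable {E : Type*} [NormedAddCommGroup E] [NormedSpace ℂ E]
  {M : Type*} [TopologicalSpace M] [ChartedSpace E M] {k : ℕ}

/-- **Pointwise, `dg₀ ∧ ⋯ ∧ dg_{k-1}` is the iterated wedge of the differentials** (the two
recursions agree definitionally, slot by slot). [folklore] -/
theorem dWedge_apply (k : ℕ) (g : Fin k → M → ℂ) (x : M) :
    dWedge k g x =
      (ContinuousAlternatingMap.iterWedge (𝕜 := ℝ) (V := E) (A := ℂ) k (fun i ↦ dFun (g i) x) :
        E [⋀^Fin k]→L[ℝ] ℂ) := by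
  induction k with
  | zero => rfl
  | succ k ih =>
    rw [ContinuousAlternatingMap.iterWedge_succ]
    change (ContinuousAlternatingMap.domDomCongr (finCongr (Nat.add_comm 1 k))
        (ContinuousAlternatingMap.wedge (𝕜 := ℝ) (V := E) (A := ℂ) (dFun (g 0) x)
          (dWedge k (Fin.tail g) x)) : E [⋀^Fin (k + 1)]→L[ℝ] ℂ) = _
    rw [ih]
    rfl

variable [IsManifold 𝓘(ℝ, E) ∞ M]

/-- `dg` is smooth at every point if `g` is `C^∞`. [cite: Warner1983, 2.20] -/
theorem smoothAt_dFun {g : M → ℂ} (hg : ContMDiff 𝓘(ℝ, E) 𝓘(ℝ, ℂ) ∞ g) (x : M) :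
    (dFun g : MForm 𝓘(ℝ, E) M ℂ 1).SmoothAt x :=
  MForm.SmoothAt.mextDeriv (Eventually.of_forall fun z ↦ MForm.smoothAt_ofFun_of_contMDiffAt (hg z))

/-- `d(dg) = 0` for `g` of class `C^∞` (`d ∘ d = 0`). [cite: Warner1983, 2.20] -/
theorem mextDeriv_dFun {g : M → ℂ} (hg : ContMDiff 𝓘(ℝ, E) 𝓘(ℝ, ℂ) ∞ g) :
    mextDeriv (dFun g : MForm 𝓘(ℝ, E) M ℂ 1) = 0 := by
  funext x
  exact mextDeriv_mextDeriv_of_smoothAt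
    (Eventually.of_forall fun z ↦ MForm.smoothAt_ofFun_of_contMDiffAt (hg z))

/-- `dg₀ ∧ ⋯ ∧ dg_{k-1}` is smooth at every point if the `gᵢ` are `C^∞`. [cite: Warner1983, 2.17] -/
theorem smoothAt_dWedge {k : ℕ} {g : Fin k → M → ℂ} (hg : ∀ i, ContMDiff 𝓘(ℝ, E) 𝓘(ℝ, ℂ) ∞ (g i))
    (x : M) : (dWedge k g : MForm 𝓘(ℝ, E) M ℂ k).SmoothAt x := by
  induction k with
  | zero => exact MForm.smoothAt_ofFun_of_contMDiffAt contMDiffAt_const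
  | succ k ih =>
    exact ((smoothAt_dFun (hg 0) x).wedge (ih (fun i ↦ hg i.succ))).castDeg _

/-- `dg₀ ∧ ⋯ ∧ dg_{k-1}` is a smooth form if the `gᵢ` are `C^∞`. [cite: Warner1983, 2.17] -/
theorem isSmoothForm_dWedge {k : ℕ} {g : Fin k → M → ℂ}
    (hg : ∀ i, ContMDiff 𝓘(ℝ, E) 𝓘(ℝ, ℂ) ∞ (g i)) :
    IsSmoothForm (dWedge k g : MForm 𝓘(ℝ, E) M ℂ k) :=
  fun x ↦ smoothAt_dWedge hg x

/-- **`d(dg₀ ∧ ⋯ ∧ dg_{k-1}) = 0`** for `C^∞` functions `gᵢ` (Leibniz rule and `d ∘ d = 0`).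
[cite: Warner1983, 2.20] -/
theorem mextDeriv_dWedge {k : ℕ} {g : Fin k → M → ℂ} (hg : ∀ i, ContMDiff 𝓘(ℝ, E) 𝓘(ℝ, ℂ) ∞ (g i)) :
    mextDeriv (dWedge k g : MForm 𝓘(ℝ, E) M ℂ k) = 0 := by
  haveI : WedgeFacts 𝓘(ℝ, E) M ℂ :=
    wedgeFacts_of_comm (ContinuousAlternatingMap.WedgeComm_holds ℝ E ℂ)
  induction k with
  | zero => exact mextDeriv_ofFun_const (1 : ℂ)
  | succ k ih =>
    change mextDeriv (((dFun (g 0)).wedge (dWedge k (Fin.tail g))).castDeg (Nat.add_comm 1 k)) = 0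
    rw [mextDeriv_castDeg, mextDeriv_wedge ((isSmoothForm_iff_smoothAt _).2 (smoothAt_dFun (hg 0)))
      (isSmoothForm_dWedge (g := Fin.tail g) fun i ↦ hg i.succ), mextDeriv_dFun (hg 0),
      ih (g := Fin.tail g) (fun i ↦ hg i.succ), MForm.zero_wedge, MForm.wedge_zero,
      MForm.castDeg_zero, smul_zero, add_zero, MForm.castDeg_zero]

omit [IsManifold 𝓘(ℝ, E) ∞ M] in
/-- A function times a form is the wedge with a `0`-form, cast from degree `0 + k`. [folklore] -/
theorem funSmul_eq_castDeg_ofFun_wedge (f : M → ℂ) (β : MForm 𝓘(ℝ, E) M ℂ k) :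
    (fun x ↦ f x • β x : MForm 𝓘(ℝ, E) M ℂ k) =
      ((MForm.ofFun 𝓘(ℝ, E) f).wedge β).castDeg (Nat.zero_add k) := by
  rw [MForm.ofFun_wedge, MForm.castDeg_castDeg]
  exact (MForm.castDeg_eq_self _ _).symm

/-- **`d(f · dg₁ ∧ ⋯ ∧ dg_k) = df ∧ dg₁ ∧ ⋯ ∧ dg_k`** for `C^∞` functions (Leibniz rule and
`d(dg₁ ∧ ⋯) = 0`). [cite: Warner1983, 2.20] -/
theorem mextDeriv_funSmul_dWedge {k : ℕ} {f : M → ℂ} {g : Fin k → M → ℂ}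
    (hf : ContMDiff 𝓘(ℝ, E) 𝓘(ℝ, ℂ) ∞ f) (hg : ∀ i, ContMDiff 𝓘(ℝ, E) 𝓘(ℝ, ℂ) ∞ (g i)) :
    mextDeriv (fun x ↦ f x • dWedge k g x : MForm 𝓘(ℝ, E) M ℂ k) =
      dWedge (k + 1) (Fin.cons f g) := by
  haveI : WedgeFacts 𝓘(ℝ, E) M ℂ :=
    wedgeFacts_of_comm (ContinuousAlternatingMap.WedgeComm_holds ℝ E ℂ)
  have hfs : IsSmoothForm (MForm.ofFun 𝓘(ℝ, E) f) :=
    fun x ↦ MForm.smoothAt_ofFun_of_contMDiffAt (hf x)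
  rw [funSmul_eq_castDeg_ofFun_wedge, mextDeriv_castDeg, mextDeriv_wedge hfs (isSmoothForm_dWedge hg),
    mextDeriv_dWedge hg, MForm.wedge_zero, smul_zero, add_zero, MForm.castDeg_castDeg, dWedge,
    Fin.cons_zero, Fin.tail_cons]
  rfl

end Forms

/-! ### Regular functions on an analytic model are smooth -/

namespace AnalyticModel

variable {E : Type} [NormedAddCommGroup E] [NormedSpace ℂ E] [FiniteDimensional ℂ E] {m : ℕ}
  {Y : Motives.SchemeOver ℂ} (A : AnalyticModel E m Y)

/-- A regular function on an AFFINE open `U`, read on `Y^an`, is holomorphic on `φ⁻¹(U(ℂ))`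
(`IsAnalytification`). [cite: SerreGAGA1956, §2] -/
theorem mdifferentiableOn_evalOrZero (U : Y.left.affineOpens) (s : Γ(Y.left, ↑U)) :
    MDifferentiableOn 𝓘(ℂ, E) 𝓘(ℂ, ℂ)
      (fun x ↦ Motives.AlgPoints.evalOrZero (↑U : Y.left.Opens) s (A.toComplexPoints x))
      (A.toComplexPoints ⁻¹' {P | P.pt ∈ (↑U : Y.left.Opens)}) :=
  A.isAnalytification.mdifferentiableOn_evalOrZero U s

/-- A global regular function on an affine `Y`, read on `Y^an`, is holomorphic (private copy of
`AnalyticModel.mdifferentiable_regularFun` of `AnalyticModelRealizePullback`). [cite: SerreGAGA1956, §2] -/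
private theorem mdifferentiable_regularFun' [IsAffine Y.left] (s : Γ(Y.left, ⊤)) :
    MDifferentiable 𝓘(ℂ, E) 𝓘(ℂ, ℂ) (A.regularFun s) := by
  have h := A.mdifferentiableOn_evalOrZero ⟨⊤, isAffineOpen_top Y.left⟩ s
  intro x
  exact (h x trivial).mdifferentiableAt (Filter.univ_mem' fun _ ↦ trivial)

/-- A global regular function on an affine `Y`, read on `Y^an`, is real `C^∞` (private copy of
`AnalyticModel.contMDiff_regularFun` of `AnalyticModelRealizePullback`). [cite: SerreGAGA1956, §2] -/
private theorem contMDiff_regularFun' [IsAffine Y.left] (s : Γ(Y.left, ⊤)) :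
    ContMDiff 𝓘(ℝ, E) 𝓘(ℝ, ℂ) ∞ (A.regularFun s) := by
  haveI : CompleteSpace ℂ := inferInstance
  have h := contMDiffOn_real_of_mdifferentiableOn_complex
    (A.mdifferentiable_regularFun' s).mdifferentiableOn isOpen_univ
  exact fun x ↦ (h x (Set.mem_univ x)).contMDiffAt Filter.univ_mem

/-- Regular functions read on `Y^an` are multiplicative (evaluation at a point is a ring
homomorphism). [folklore] -/
theorem regularFun_mul [IsAffine Y.left] (s t : Γ(Y.left, ⊤)) :
    A.regularFun (s * t) = fun x ↦ A.regularFun s x * A.regularFun t x := by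
  funext x
  simp only [AnalyticModel.regularFun]
  have hx : (A.toComplexPoints x).pt ∈ (⊤ : Y.left.Opens) := trivial
  rw [Motives.AlgPoints.evalOrZero_of_mem _ hx, Motives.AlgPoints.evalOrZero_of_mem _ hx,
    Motives.AlgPoints.evalOrZero_of_mem _ hx]
  exact map_mul (Y.left.evaluation ⊤ _ hx ≫ (A.toComplexPoints x).resHom).hom s t

/-- The regular function `1` reads as the constant `1`. [folklore] -/
theorem regularFun_one [IsAffine Y.left] : A.regularFun (1 : Γ(Y.left, ⊤)) = fun _ ↦ 1 := by
  funext x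
  simp only [AnalyticModel.regularFun]
  have hx : (A.toComplexPoints x).pt ∈ (⊤ : Y.left.Opens) := trivial
  rw [Motives.AlgPoints.evalOrZero_of_mem _ hx]
  exact map_one (Y.left.evaluation ⊤ _ hx ≫ (A.toComplexPoints x).resHom).hom

end AnalyticModel

/-! ### The formal derivative of an expression; smoothness and `d` of realisations -/

namespace AlgFormExpr

variable {Y : Motives.SchemeOver ℂ} {k : ℕ}

/-- The **formal exterior derivative** of an expression:
`D(∑ⱼ fⱼ dg_{j,1} ∧ ⋯ ∧ dg_{j,k}) = ∑ⱼ 1 · dfⱼ ∧ dg_{j,1} ∧ ⋯ ∧ dg_{j,k}`. [cite: Grothendieck1966, §1] -/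
def D (ξ : AlgFormExpr Y k) : AlgFormExpr Y (k + 1) where
  size := ξ.size
  coef _ := 1
  arg j := Fin.cons (ξ.coef j) (ξ.arg j)

/-- **Conjugation of expressions commutes with the formal derivative** (the conjugation map
`Γ(Y, 𝒪) → Γ(Y^σ, 𝒪)` is a ring homomorphism, so it sends the coefficient `1` to `1`).
[cite: CharlesSchnell2014Notes, §11.2.2 (11.2.2)] -/
theorem conj_D (σ : ℂ ≃+* ℂ) (ξ : AlgFormExpr Y k) : (ξ.D).conj σ = (ξ.conj σ).D := by
  simp only [AlgFormExpr.D, AlgFormExpr.conj, map_one]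
  congr 1
  funext j i
  refine Fin.cases ?_ (fun l ↦ ?_) i
  · simp
  · simp

variable {E : Type} [NormedAddCommGroup E] [NormedSpace ℂ E] [FiniteDimensional ℂ E] {m : ℕ}
  [IsAffine Y.left] (ξ : AlgFormExpr Y k) (A : AnalyticModel E m Y)

/-- Realisations are smooth at every point. [cite: Grothendieck1966, §1] -/
theorem smoothAt_realize (x : A.carrier) : (ξ.realize A).SmoothAt x := by
  unfold AlgFormExpr.realize
  refine MForm.smoothAt_sum _ fun j _ ↦ ?_
  exact MForm.smoothAt_funSmul ((A.contMDiff_regularFun' (ξ.coef j)) x)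
    (smoothAt_dWedge (fun i ↦ A.contMDiff_regularFun' (ξ.arg j i)) x)

/-- **Realisations of algebraic form expressions are smooth forms.** [cite: Grothendieck1966, §1] -/
theorem isSmoothForm_realize : IsSmoothForm (ξ.realize A) :=
  fun x ↦ ξ.smoothAt_realize A x

/-- **`d` of a realisation is the realisation of the formal derivative**:
`d(∑ⱼ fⱼ dg_{j,•}) = ∑ⱼ dfⱼ ∧ dg_{j,•}` (Leibniz rule; `d(dg) = 0`). [cite: Grothendieck1966, §1] -/
theorem mextDeriv_realize : mextDeriv (ξ.realize A) = (ξ.D).realize A := by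
  have hd : ∀ j : Fin ξ.size,
      mextDeriv (fun x ↦ A.regularFun (ξ.coef j) x •
          dWedge k (fun i ↦ A.regularFun (ξ.arg j i)) x : MForm 𝓘(ℝ, E) A.carrier ℂ k) =
        fun x ↦ A.regularFun ((ξ.D).coef j) x •
          dWedge (k + 1) (fun i ↦ A.regularFun ((ξ.D).arg j i)) x := by
    intro j
    rw [mextDeriv_funSmul_dWedge (A.contMDiff_regularFun' (ξ.coef j))
      (fun i ↦ A.contMDiff_regularFun' (ξ.arg j i))]
    -- the `D`-monomial: coefficient `1`, arguments `cons f g`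
    have h1 : A.regularFun ((ξ.D).coef j) = fun _ ↦ (1 : ℂ) := A.regularFun_one
    have h2 : (fun i ↦ A.regularFun ((ξ.D).arg j i)) =
        Fin.cons (A.regularFun (ξ.coef j)) (fun i ↦ A.regularFun (ξ.arg j i)) := by
      funext i
      refine Fin.cases ?_ (fun l ↦ ?_) i
      · simp only [AlgFormExpr.D, Fin.cons_zero]
      · simp only [AlgFormExpr.D, Fin.cons_succ]
    rw [h1, h2]
    funext x
    rw [one_smul]
  funext x
  have hs : ∀ j ∈ (Finset.univ : Finset (Fin ξ.size)),
      MForm.SmoothAt (fun x ↦ A.regularFun (ξ.coef j) x •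
        dWedge k (fun i ↦ A.regularFun (ξ.arg j i)) x : MForm 𝓘(ℝ, E) A.carrier ℂ k) x :=
    fun j _ ↦ MForm.smoothAt_funSmul ((A.contMDiff_regularFun' (ξ.coef j)) x)
      (smoothAt_dWedge (fun i ↦ A.contMDiff_regularFun' (ξ.arg j i)) x)
  unfold AlgFormExpr.realize
  rw [mextDeriv_sum_apply_of_smoothAt _ hs, Finset.sum_apply]
  refine Finset.sum_congr rfl fun j _ ↦ ?_
  rw [hd j]

/-- **Closedness of a realisation is the vanishing of the realised formal derivative.**
[cite: Grothendieck1966, §1] -/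
theorem realize_mem_cclosedSmoothForms_iff :
    ξ.realize A ∈ cclosedSmoothForms E A.carrier k ↔ (ξ.D).realize A = 0 := by
  rw [mem_cclosedSmoothForms_iff, IsClosedForm, mextDeriv_realize]
  exact ⟨fun h ↦ h.2, fun h ↦ ⟨ξ.isSmoothForm_realize A, h⟩⟩

omit [IsAffine Y.left] in
/-- **Pointwise formula**: at `x`, the realisation is
`∑ⱼ fⱼ(φ x) · (dg_{j,1})ₓ ∧ ⋯ ∧ (dg_{j,k})ₓ`, an iterated wedge of the `1`-forms `(dg)ₓ`.
[cite: Grothendieck1966, §1] -/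
theorem realize_apply (x : A.carrier) :
    ξ.realize A x =
      (∑ j : Fin ξ.size, A.regularFun (ξ.coef j) x •
        ContinuousAlternatingMap.iterWedge (𝕜 := ℝ) (V := E) (A := ℂ) k
          (fun i ↦ dFun (A.regularFun (ξ.arg j i)) x) : E [⋀^Fin k]→L[ℝ] ℂ) := by
  unfold AlgFormExpr.realize
  rw [Finset.sum_apply]
  exact Finset.sum_congr rfl fun j _ ↦ by rw [dWedge_apply]; rfl

end AlgFormExpr

end HodgeTheory

end Literature.AlgebraicGeometry.HodgeTheory

end
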